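import Literature.NumberTheory.Automorphic.UnboundedDenominators
import Literature.NumberTheory.Automorphic.WohlfahrtTheorem
import Summits.BirchSwinnertonDyer.BirchSwinnertonDyer.Theorems.EisensteinDepletionAtTwoStarGO2UBDGroupLemma
import HarnessLib

/-!
# The congruence core of THEOREM A′ (line `nsf`, crux `StarOptBNSF`, stmt-BirchSwinnertonDyer-27047)

The cell's THEOREM A′ («`J₁(N)(ℚ)[2]` has no point that is formal at `2`», HOME/p2/g33/THEOREM-A-v3.md)
ends with two steps that use no arithmetic geometry at all:

* (4) **Unbounded denominators** (Calegari–Dimitrov–Tang, *J. Amer. Math. Soc.* **38** (2025),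
  Thm. 1.0.1) — in the tree as the NAMED FACT
  `Literature.NumberTheory.Automorphic.CalegariDimitrovTang2025_unboundedDenominators`
  (`Literature/NumberTheory/Automorphic/UnboundedDenominators.lean`): a modular form for a finite-index
  `Γ ≤ SL(2, ℤ)` with an integral `q`-expansion at a strict period is modular for a congruence subgroup;
* (5) **Wohlfahrt's level theorem** (Wohlfahrt, *Illinois J. Math.* **8** (1964), Thm. 2) — PROVED in
  the tree, `Literature.NumberTheory.Automorphic.Wohlfahrt.Gamma_le_of_isCongruenceSubgroup_of_forall_conj_T_pow_mem`
  (`Literature/NumberTheory/Automorphic/WohlfahrtTheorem.lean`): a congruence subgroup containing every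
  conjugate of `T^N` contains `Γ(N)`; and the `Γ₁(N) = ⟨Γ(N), T⟩` bookkeeping of
  `Theorems/EisensteinDepletionAtTwoStarGO2UBDGroupLemma.lean` (namespace `…DepletionAtTwo.UBD`, the
  line's GEN 6 brick, which did step (5) for index-`2` subgroups at ODD level).

This file supplies the missing modular-forms half of step (4) and assembles (4)–(5) into ONE kernel
theorem, conditional only on the tree's UBD named fact:

**`false_of_antiinvariant_integral_cuspForm`** — for `N ≥ 3` there is no finite-index
`Γ′ ≤ Γ₁(N)`, `Γ′ ≠ Γ₁(N)`, containing every element of `Γ₁(N)` of trace `2`, that carries a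
non-zero `h ∈ S₂(Γ′)` anti-invariant under `Γ₁(N) ∖ Γ′` some non-zero integer multiple of which has
an integral `q`-expansion (Mathlib `UpperHalfPlane.qExpansion 1`) at `∞`.

Argument: UBD makes `M·h` a modular form for a congruence subgroup, so `h` is invariant under some
`Γ(M₁)`; anti-invariance forces `Γ(M₁) ∩ Γ₁(N) ≤ Γ′` (`gamma_le_of_antiinvariant`); every conjugate
of `T^N` is a trace-`2` element of `Γ(N) ≤ Γ₁(N)`, hence lies in `Γ′`, so Wohlfahrt gives
`Γ(N) ≤ Γ′`; finally `T ∈ Γ′` and `Γ₁(N) = ⟨Γ(N), T⟩` give `Γ₁(N) ≤ Γ′`, contradiction.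
(No parity hypothesis on `N` and no index computation: properness of `Γ′` and anti-invariance on the
whole of `Γ₁(N) ∖ Γ′` replace «index `2`, `N` odd» of the GEN 6 brick.)

In the line this is the part of «Stevens' conjecture at `2` for the `X₁(N)`-optimal curve»
(`stub_stevensAtTwoX1`) that is NOT arithmetic geometry: the geometric steps (1)–(3) of THEOREM A′
(the parity double cover of `X₁(N)` cut out by a formal rational `2`-torsion point of `E₁ ↪ J₁(N)`
carries an anti-invariant differential with bounded denominators) produce exactly the data
`(Γ′, h, M)` refuted here.  Nothing in this file reads `r_an`; BSD is not proved by it.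
-/

set_option linter.dupNamespace false
set_option autoImplicit false

noncomputable section

open scoped MatrixGroups ModularForm
open CongruenceSubgroup Matrix.SpecialLinearGroup UpperHalfPlane
open Literature.NumberTheory.Automorphic

namespace Summit.BirchSwinnertonDyer.BirchSwinnertonDyer.Theorems.DepletionAtTwo.CongruenceCore

/-! ### Group theory in `SL(2, ℤ)` -/

/-- The trace of `T` is `2`. [folklore] -/
theorem trace_T : (ModularGroup.T : Matrix (Fin 2) (Fin 2) ℤ).trace = 2 := by
  rw [Matrix.trace_fin_two, ModularGroup.coe_T]
  simp

/-- The trace of a conjugate `σ T^N σ⁻¹` is `2` (it is unipotent). [folklore] -/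
theorem trace_conj_T_pow (N : ℕ) (σ : SL(2, ℤ)) :
    ((σ * ModularGroup.T ^ N * σ⁻¹ : SL(2, ℤ)) : Matrix (Fin 2) (Fin 2) ℤ).trace = 2 := by
  have hTN : ((ModularGroup.T ^ N : SL(2, ℤ)) : Matrix (Fin 2) (Fin 2) ℤ) = !![1, (N : ℤ); 0, 1] := by
    have := ModularGroup.coe_T_zpow (N : ℤ)
    rwa [zpow_natCast] at this
  rw [Matrix.SpecialLinearGroup.coe_mul, Matrix.SpecialLinearGroup.coe_mul,
    Matrix.trace_mul_cycle, Matrix.SpecialLinearGroup.coe_inv, Matrix.adjugate_mul,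
    Matrix.SpecialLinearGroup.det_coe, one_smul, Matrix.one_mul, hTN, Matrix.trace_fin_two]
  simp

/-- `Γ(N) ≤ Γ₁(N)`. [folklore] -/
theorem gamma_le_gamma1 (N : ℕ) : Gamma N ≤ Gamma1 N := by
  intro γ hγ
  rw [Gamma_mem] at hγ
  rw [Gamma1_mem]
  exact ⟨hγ.1, hγ.2.2.2, hγ.2.2.1⟩

/-- `Γ₁(N) = ⟨Γ(N), T⟩`: a subgroup containing `Γ(N)` and `T` contains `Γ₁(N)`
(`γ = (γ T^{-b}) · T^{b}` with `b = γ₀₁` and `γ T^{-b} ∈ Γ(N)`,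
`UBD.mul_T_zpow_neg_mem_Gamma_of_mem_Gamma1`). [folklore] -/
theorem gamma1_le_of_gamma_le_of_T_mem {N : ℕ} {Γ' : Subgroup SL(2, ℤ)} (hΓ : Gamma N ≤ Γ')
    (hT : ModularGroup.T ∈ Γ') : Gamma1 N ≤ Γ' := by
  intro γ hγ
  have h1 : γ * ModularGroup.T ^ (-(γ 0 1)) ∈ Γ' := hΓ (UBD.mul_T_zpow_neg_mem_Gamma_of_mem_Gamma1 hγ)
  have h2 : ModularGroup.T ^ (γ 0 1) ∈ Γ' := Γ'.zpow_mem hT _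
  have e : γ = γ * ModularGroup.T ^ (-(γ 0 1)) * ModularGroup.T ^ (γ 0 1) := by
    rw [mul_assoc, ← zpow_add, neg_add_cancel, zpow_zero, mul_one]
  rw [e]
  exact Γ'.mul_mem h1 h2

/-! ### Slash-action bookkeeping -/

/-- A cusp form on `Γ′ ≤ SL(2, ℤ)` is invariant under the weight-`k` slash action of every
`γ ∈ Γ′`. [folklore] -/
theorem slash_eq_of_mem {Γ' : Subgroup SL(2, ℤ)} {k : ℤ} (h : CuspForm Γ' k) {γ : SL(2, ℤ)}
    (hγ : γ ∈ Γ') : (h : ℍ → ℂ) ∣[k] γ = h := by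
  rw [ModularForm.SL_slash]
  exact SlashInvariantForm.slash_action_eqn h _ ⟨γ, hγ, rfl⟩

/-- A modular form on `Γ″ ≤ SL(2, ℤ)` is invariant under the weight-`k` slash action of every
`γ ∈ Γ″`. [folklore] -/
theorem slash_eq_of_mem' {Γ'' : Subgroup SL(2, ℤ)} {k : ℤ} (g : ModularForm Γ'' k) {γ : SL(2, ℤ)}
    (hγ : γ ∈ Γ'') : (g : ℍ → ℂ) ∣[k] γ = g := by
  rw [ModularForm.SL_slash]
  exact SlashInvariantForm.slash_action_eqn g _ ⟨γ, hγ, rfl⟩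

/-- A function with `h ∣ γ = h` and `h ∣ γ = -h` is zero. [folklore] -/
theorem eq_zero_of_slash_eq_of_slash_eq_neg {k : ℤ} {h : ℍ → ℂ} {γ : SL(2, ℤ)}
    (h₁ : h ∣[k] γ = h) (h₂ : h ∣[k] γ = -h) : h = 0 := by
  have hh : h = -h := h₁.symm.trans h₂
  funext τ
  have := congr_fun hh τ
  simp only [Pi.neg_apply] at this
  have h2 : h τ + h τ = 0 := by linear_combination this
  rwa [add_self_eq_zero] at h2

/-- `1` is a strict period of (the image in `GL(2, ℝ)` of) any `Γ′ ≤ SL(2, ℤ)` containing `T`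
(tree: `Wohlfahrt.natCast_mem_strictPeriods_iff_T_pow_mem`). [folklore] -/
theorem one_mem_strictPeriods_of_T_mem {Γ' : Subgroup SL(2, ℤ)} (hT : ModularGroup.T ∈ Γ') :
    (1 : ℝ) ∈ (Γ' : Subgroup (GL (Fin 2) ℝ)).strictPeriods := by
  have h := (Wohlfahrt.natCast_mem_strictPeriods_iff_T_pow_mem (Λ := Γ') (N := 1)).mpr
    (by rw [pow_one]; exact hT)
  rwa [Nat.cast_one] at h

/-! ### Step (4): unbounded denominators make the parity group a congruence subgroup -/

/-- **THEOREM A′, step (4) (kernel form, modulo the tree's UBD named fact).**  Let `Γ′ ≤ SL(2, ℤ)` be a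
finite-index subgroup containing `T`, and `h ∈ S₂(Γ′)` a NON-ZERO cusp form, anti-invariant under
every element of `Γ₁(N) ∖ Γ′`, such that for some integer `M ≠ 0` the `q`-expansion of `M·h` at
`∞` (parameter `q = e^{2πiτ}`, Mathlib `UpperHalfPlane.qExpansion 1`) has integer coefficients.
Then `Γ(M₀) ≤ Γ′` for some `M₀ ≠ 0` with `N ∣ M₀`; in particular `Γ′` is a congruence subgroup.
Proof: Calegari–Dimitrov–Tang make `M·h` modular for a congruence subgroup `⊇ Γ(M₁)`, so `h` is
`Γ(M₁)`-invariant; an element of `Γ(M₁) ∩ Γ₁(N)` outside `Γ′` would give `h = -h`, `h = 0`.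
[cite: CalegariDimitrovTang2025, Thm. 1.0.1] -/
theorem gamma_le_of_antiinvariant (hUBD : CalegariDimitrovTang2025_unboundedDenominators)
    {N : ℕ} (hN : N ≠ 0) {Γ' : Subgroup SL(2, ℤ)} [Γ'.FiniteIndex]
    (hT : ModularGroup.T ∈ Γ') (h : CuspForm Γ' 2) (hh : (h : ℍ → ℂ) ≠ 0)
    (hanti : ∀ γ ∈ Gamma1 N, γ ∉ Γ' → (h : ℍ → ℂ) ∣[(2 : ℤ)] γ = -h)
    {M : ℕ} (hM : M ≠ 0)
    (hint : ∀ n : ℕ, ∃ z : ℤ,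
      PowerSeries.coeff n (qExpansion (1 : ℝ) (fun τ : ℍ ↦ (M : ℂ) * h τ)) = (z : ℂ)) :
    ∃ M₀ : ℕ, M₀ ≠ 0 ∧ N ∣ M₀ ∧ Gamma M₀ ≤ Γ' := by
  -- the integral form `M • h`, as a Mathlib modular form on `Γ′`
  set g : ModularForm Γ' 2 := ModularFormClass.modularForm ((M : ℝ) • h) with hg
  have hgcoe' : (g : ℍ → ℂ) = (M : ℝ) • (h : ℍ → ℂ) := by
    rw [hg, ModularFormClass.coe_modularForm, CuspForm.coe_smul]
  have hgcoe : (g : ℍ → ℂ) = fun τ : ℍ ↦ (M : ℂ) * h τ := by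
    rw [hgcoe']
    funext τ
    rw [Pi.smul_apply, Complex.real_smul, Complex.ofReal_natCast]
  have hint' : ∀ n : ℕ, ∃ z : ℤ, PowerSeries.coeff n (qExpansion (1 : ℝ) g) = (z : ℂ) := by
    intro n; rw [hgcoe]; exact hint n
  -- (4) unbounded denominators
  obtain ⟨Γ'', g', hcong, hg'⟩ :=
    hUBD Γ' 2 g 1 one_pos (by rw [Nat.cast_one]; exact one_mem_strictPeriods_of_T_mem hT)
      (by intro n; rw [Nat.cast_one]; exact hint' n)
  obtain ⟨M₁, hM₁, hM₁le⟩ := hcong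
  -- `h` is `Γ(M₁)`-invariant
  have hMR : (M : ℝ) ≠ 0 := Nat.cast_ne_zero.mpr hM
  have hinv : ∀ γ ∈ Gamma M₁, (h : ℍ → ℂ) ∣[(2 : ℤ)] γ = h := by
    intro γ hγ
    have H : (g : ℍ → ℂ) ∣[(2 : ℤ)] γ = g := by
      rw [← hg']; exact slash_eq_of_mem' g' (hM₁le hγ)
    rw [hgcoe', ModularForm.SL_smul_slash] at H
    exact smul_right_injective (ℍ → ℂ) hMR H
  -- anti-invariance: `Γ(M₁) ∩ Γ₁(N) ≤ Γ′`, hence `Γ(M₁ N) ≤ Γ′`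
  have hsub : ∀ γ ∈ Gamma M₁, γ ∈ Gamma1 N → γ ∈ Γ' := by
    intro γ hγM hγ1
    by_contra hγ'
    exact hh (eq_zero_of_slash_eq_of_slash_eq_neg (hinv γ hγM) (hanti γ hγ1 hγ'))
  refine ⟨M₁ * N, mul_ne_zero hM₁ hN, dvd_mul_left N M₁, fun γ hγ ↦ ?_⟩
  exact hsub γ (Wohlfahrt.Gamma_le_Gamma_of_dvd (dvd_mul_right M₁ N) hγ)
    (gamma_le_gamma1 N (Wohlfahrt.Gamma_le_Gamma_of_dvd (dvd_mul_left N M₁) hγ))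

/-- Step (4), congruence form: under the hypotheses of `gamma_le_of_antiinvariant`, `Γ′` is a
congruence subgroup. [cite: CalegariDimitrovTang2025, Thm. 1.0.1] -/
theorem isCongruenceSubgroup_of_antiinvariant (hUBD : CalegariDimitrovTang2025_unboundedDenominators)
    {N : ℕ} (hN : N ≠ 0) {Γ' : Subgroup SL(2, ℤ)} [Γ'.FiniteIndex]
    (hT : ModularGroup.T ∈ Γ') (h : CuspForm Γ' 2) (hh : (h : ℍ → ℂ) ≠ 0)
    (hanti : ∀ γ ∈ Gamma1 N, γ ∉ Γ' → (h : ℍ → ℂ) ∣[(2 : ℤ)] γ = -h)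
    {M : ℕ} (hM : M ≠ 0)
    (hint : ∀ n : ℕ, ∃ z : ℤ,
      PowerSeries.coeff n (qExpansion (1 : ℝ) (fun τ : ℍ ↦ (M : ℂ) * h τ)) = (z : ℂ)) :
    IsCongruenceSubgroup Γ' := by
  obtain ⟨M₀, hM₀, -, hle₀⟩ := gamma_le_of_antiinvariant hUBD hN hT h hh hanti hM hint
  exact ⟨M₀, hM₀, hle₀⟩

/-! ### Steps (4)–(5) assembled -/

/-- **Congruence core of THEOREM A′** (THEOREM-A-v3.md, steps (4)–(5), kernel form; conditional only
on the tree's named fact `CalegariDimitrovTang2025_unboundedDenominators`, Wohlfahrt's theorem being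
PROVED in the tree).  For `N ≥ 3` there is no finite-index `Γ′ ≤ SL(2, ℤ)` not containing `Γ₁(N)`, containing
every element of `Γ₁(N)` of trace `2` (every unipotent: the monodromy group of a double cover of
`X₁(N)` étale at all cusps is such a `Γ′`), carrying a non-zero `h ∈ S₂(Γ′)` anti-invariant under
`Γ₁(N) ∖ Γ′` with `M·h` (`M ≠ 0`) integral at `∞`.  Proof: step (4) gives `Γ(M₀) ≤ Γ′`
(congruence); the conjugates of `T^N` are trace-`2` elements of `Γ(N) ≤ Γ₁(N)`, so lie in `Γ′`, and
Wohlfahrt (`Wohlfahrt.Gamma_le_of_isCongruenceSubgroup_of_forall_conj_T_pow_mem`) gives `Γ(N) ≤ Γ′`;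
with `T ∈ Γ′`, `Γ₁(N) = ⟨Γ(N), T⟩ ≤ Γ′` — contradiction.
[cite: CalegariDimitrovTang2025, Thm. 1.0.1] [cite: Wohlfahrt1964, Thm. 2] -/
theorem false_of_antiinvariant_integral_cuspForm
    (hUBD : CalegariDimitrovTang2025_unboundedDenominators)
    {N : ℕ} (hN : 3 ≤ N) {Γ' : Subgroup SL(2, ℤ)} [Γ'.FiniteIndex]
    (hpar : ∀ γ ∈ Gamma1 N, (γ : Matrix (Fin 2) (Fin 2) ℤ).trace = 2 → γ ∈ Γ')
    (hne : ∃ γ₀ ∈ Gamma1 N, γ₀ ∉ Γ')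
    (h : CuspForm Γ' 2) (hh : (h : ℍ → ℂ) ≠ 0)
    (hanti : ∀ γ ∈ Gamma1 N, γ ∉ Γ' → (h : ℍ → ℂ) ∣[(2 : ℤ)] γ = -h)
    {M : ℕ} (hM : M ≠ 0)
    (hint : ∀ n : ℕ, ∃ z : ℤ,
      PowerSeries.coeff n (qExpansion (1 : ℝ) (fun τ : ℍ ↦ (M : ℂ) * h τ)) = (z : ℂ)) :
    False := by
  have hN0 : N ≠ 0 := by omega
  have hT : ModularGroup.T ∈ Γ' := hpar _ (UBD.T_mem_Gamma1 N) trace_T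
  -- (4): `Γ′` is a congruence subgroup
  have hcong : IsCongruenceSubgroup Γ' :=
    isCongruenceSubgroup_of_antiinvariant hUBD hN0 hT h hh hanti hM hint
  -- (5): Wohlfahrt — every conjugate of `T^N` is a trace-`2` element of `Γ₁(N)`, hence in `Γ′`
  have hwidth : ∀ σ : SL(2, ℤ), σ * ModularGroup.T ^ N * σ⁻¹ ∈ Γ' := fun σ ↦
    hpar _ (UBD.conj_T_pow_mem_Gamma1 N σ) (trace_conj_T_pow N σ)
  have hGammaN : Gamma N ≤ Γ' :=
    Wohlfahrt.Gamma_le_of_isCongruenceSubgroup_of_forall_conj_T_pow_mem hcong hwidth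
  -- `Γ₁(N) = ⟨Γ(N), T⟩ ≤ Γ′`: contradiction with properness
  obtain ⟨γ₀, hγ₀, hγ₀'⟩ := hne
  exact hγ₀' (gamma1_le_of_gamma_le_of_T_mem hGammaN hT hγ₀)

/-! ### Appended (lead star-p1 GEN 9, same day): the level hypothesis is only `N ≠ 0` -/

/-- **Congruence core, sharp level hypothesis.**  Same statement and proof as
`false_of_antiinvariant_integral_cuspForm` with `3 ≤ N` weakened to `N ≠ 0`: the proof never used more (the tree's
Wohlfahrt theorem is the strict form, so no sign argument in `Γ₁(N)` is needed).  This is the form consumed on the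
`J₀(N)` side (line `kummer`, crux 27046), where the level is a conductor and only `NeZero N` is in the binders.
[cite: CalegariDimitrovTang2025, Thm. 1.0.1] [cite: Wohlfahrt1964, Thm. 2] -/
theorem false_of_antiinvariant_integral_cuspForm_of_ne_zero
    (hUBD : CalegariDimitrovTang2025_unboundedDenominators)
    {N : ℕ} (hN0 : N ≠ 0) {Γ' : Subgroup SL(2, ℤ)} [Γ'.FiniteIndex]
    (hpar : ∀ γ ∈ Gamma1 N, (γ : Matrix (Fin 2) (Fin 2) ℤ).trace = 2 → γ ∈ Γ')
    (hne : ∃ γ₀ ∈ Gamma1 N, γ₀ ∉ Γ')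
    (h : CuspForm Γ' 2) (hh : (h : ℍ → ℂ) ≠ 0)
    (hanti : ∀ γ ∈ Gamma1 N, γ ∉ Γ' → (h : ℍ → ℂ) ∣[(2 : ℤ)] γ = -h)
    {M : ℕ} (hM : M ≠ 0)
    (hint : ∀ n : ℕ, ∃ z : ℤ,
      PowerSeries.coeff n (qExpansion (1 : ℝ) (fun τ : ℍ ↦ (M : ℂ) * h τ)) = (z : ℂ)) :
    False := by
  have hT : ModularGroup.T ∈ Γ' := hpar _ (UBD.T_mem_Gamma1 N) trace_T
  have hcong : IsCongruenceSubgroup Γ' :=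
    isCongruenceSubgroup_of_antiinvariant hUBD hN0 hT h hh hanti hM hint
  have hwidth : ∀ σ : SL(2, ℤ), σ * ModularGroup.T ^ N * σ⁻¹ ∈ Γ' := fun σ ↦
    hpar _ (UBD.conj_T_pow_mem_Gamma1 N σ) (trace_conj_T_pow N σ)
  have hGammaN : Gamma N ≤ Γ' :=
    Wohlfahrt.Gamma_le_of_isCongruenceSubgroup_of_forall_conj_T_pow_mem hcong hwidth
  obtain ⟨γ₀, hγ₀, hγ₀'⟩ := hne
  exact hγ₀' (gamma1_le_of_gamma_le_of_T_mem hGammaN hT hγ₀)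

/-! ### Appended (lead star-p1 GEN 10): the core in EVERY weight

The unbounded-denominators named fact is typed for `ModularForm Γ k` of arbitrary weight `k`, and nothing in
steps (4)–(5) reads the weight.  The `E`-level route to THEOREM A′ (A″: the anti-invariant form is
`u·G` with `u = √(x∘φ₁ − x(Q))` and `G` a cusp form of some weight `k ≥ 2` killing the poles of `x∘φ₁`)
produces cusp forms of weight `k ≠ 2`, so the line needs the core in weight `k`. -/

/-- Step (4) in weight `k`: for a finite-index `Γ′ ∋ T` and a NON-ZERO `h ∈ S_k(Γ′)` anti-invariant under
`Γ₁(N) ∖ Γ′` with `M·h` (`M ≠ 0`) integral at `∞`, some `Γ(M₀) ≤ Γ′` with `M₀ ≠ 0`, `N ∣ M₀`.  Same proof as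
`gamma_le_of_antiinvariant`. [cite: CalegariDimitrovTang2025, Thm. 1.0.1] -/
theorem gamma_le_of_antiinvariant_wt (hUBD : CalegariDimitrovTang2025_unboundedDenominators)
    {N : ℕ} (hN : N ≠ 0) {Γ' : Subgroup SL(2, ℤ)} [Γ'.FiniteIndex]
    (hT : ModularGroup.T ∈ Γ') {k : ℤ} (h : CuspForm Γ' k) (hh : (h : ℍ → ℂ) ≠ 0)
    (hanti : ∀ γ ∈ Gamma1 N, γ ∉ Γ' → (h : ℍ → ℂ) ∣[k] γ = -h)
    {M : ℕ} (hM : M ≠ 0)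
    (hint : ∀ n : ℕ, ∃ z : ℤ,
      PowerSeries.coeff n (qExpansion (1 : ℝ) (fun τ : ℍ ↦ (M : ℂ) * h τ)) = (z : ℂ)) :
    ∃ M₀ : ℕ, M₀ ≠ 0 ∧ N ∣ M₀ ∧ Gamma M₀ ≤ Γ' := by
  -- the integral form `M • h`, as a Mathlib modular form on `Γ′`
  set g : ModularForm Γ' k := ModularFormClass.modularForm ((M : ℝ) • h) with hg
  have hgcoe' : (g : ℍ → ℂ) = (M : ℝ) • (h : ℍ → ℂ) := by
    rw [hg, ModularFormClass.coe_modularForm, CuspForm.coe_smul]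
  have hgcoe : (g : ℍ → ℂ) = fun τ : ℍ ↦ (M : ℂ) * h τ := by
    rw [hgcoe']
    funext τ
    rw [Pi.smul_apply, Complex.real_smul, Complex.ofReal_natCast]
  have hint' : ∀ n : ℕ, ∃ z : ℤ, PowerSeries.coeff n (qExpansion (1 : ℝ) g) = (z : ℂ) := by
    intro n; rw [hgcoe]; exact hint n
  -- (4) unbounded denominators
  obtain ⟨Γ'', g', hcong, hg'⟩ :=
    hUBD Γ' k g 1 one_pos (by rw [Nat.cast_one]; exact one_mem_strictPeriods_of_T_mem hT)
      (by intro n; rw [Nat.cast_one]; exact hint' n)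
  obtain ⟨M₁, hM₁, hM₁le⟩ := hcong
  -- `h` is `Γ(M₁)`-invariant
  have hMR : (M : ℝ) ≠ 0 := Nat.cast_ne_zero.mpr hM
  have hinv : ∀ γ ∈ Gamma M₁, (h : ℍ → ℂ) ∣[k] γ = h := by
    intro γ hγ
    have H : (g : ℍ → ℂ) ∣[k] γ = g := by
      rw [← hg']; exact slash_eq_of_mem' g' (hM₁le hγ)
    rw [hgcoe', ModularForm.SL_smul_slash] at H
    exact smul_right_injective (ℍ → ℂ) hMR H
  -- anti-invariance: `Γ(M₁) ∩ Γ₁(N) ≤ Γ′`, hence `Γ(M₁ N) ≤ Γ′`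
  have hsub : ∀ γ ∈ Gamma M₁, γ ∈ Gamma1 N → γ ∈ Γ' := by
    intro γ hγM hγ1
    by_contra hγ'
    exact hh (eq_zero_of_slash_eq_of_slash_eq_neg (hinv γ hγM) (hanti γ hγ1 hγ'))
  refine ⟨M₁ * N, mul_ne_zero hM₁ hN, dvd_mul_left N M₁, fun γ hγ ↦ ?_⟩
  exact hsub γ (Wohlfahrt.Gamma_le_Gamma_of_dvd (dvd_mul_right M₁ N) hγ)
    (gamma_le_gamma1 N (Wohlfahrt.Gamma_le_Gamma_of_dvd (dvd_mul_left N M₁) hγ))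

/-- **Congruence core of THEOREM A′ in every weight** (steps (4)–(5); conditional only on the tree's UBD
named fact).  For `N ≠ 0` there is no finite-index `Γ′ ≤ SL(2, ℤ)` not containing `Γ₁(N)`, containing every
element of `Γ₁(N)` of trace `2`, carrying a non-zero `h ∈ S_k(Γ′)` (ANY weight `k`) anti-invariant under
`Γ₁(N) ∖ Γ′` with `M·h` (`M ≠ 0`) integral at `∞`.  Same proof as
`false_of_antiinvariant_integral_cuspForm_of_ne_zero`.
[cite: CalegariDimitrovTang2025, Thm. 1.0.1] [cite: Wohlfahrt1964, Thm. 2] -/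
theorem false_of_antiinvariant_integral_cuspForm_wt
    (hUBD : CalegariDimitrovTang2025_unboundedDenominators)
    {N : ℕ} (hN0 : N ≠ 0) {Γ' : Subgroup SL(2, ℤ)} [Γ'.FiniteIndex]
    (hpar : ∀ γ ∈ Gamma1 N, (γ : Matrix (Fin 2) (Fin 2) ℤ).trace = 2 → γ ∈ Γ')
    (hne : ∃ γ₀ ∈ Gamma1 N, γ₀ ∉ Γ')
    {k : ℤ} (h : CuspForm Γ' k) (hh : (h : ℍ → ℂ) ≠ 0)
    (hanti : ∀ γ ∈ Gamma1 N, γ ∉ Γ' → (h : ℍ → ℂ) ∣[k] γ = -h)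
    {M : ℕ} (hM : M ≠ 0)
    (hint : ∀ n : ℕ, ∃ z : ℤ,
      PowerSeries.coeff n (qExpansion (1 : ℝ) (fun τ : ℍ ↦ (M : ℂ) * h τ)) = (z : ℂ)) :
    False := by
  have hT : ModularGroup.T ∈ Γ' := hpar _ (UBD.T_mem_Gamma1 N) trace_T
  obtain ⟨M₀, hM₀, -, hle₀⟩ := gamma_le_of_antiinvariant_wt hUBD hN0 hT h hh hanti hM hint
  have hcong : IsCongruenceSubgroup Γ' := ⟨M₀, hM₀, hle₀⟩
  have hwidth : ∀ σ : SL(2, ℤ), σ * ModularGroup.T ^ N * σ⁻¹ ∈ Γ' := fun σ ↦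
    hpar _ (UBD.conj_T_pow_mem_Gamma1 N σ) (trace_conj_T_pow N σ)
  have hGammaN : Gamma N ≤ Γ' :=
    Wohlfahrt.Gamma_le_of_isCongruenceSubgroup_of_forall_conj_T_pow_mem hcong hwidth
  obtain ⟨γ₀, hγ₀, hγ₀'⟩ := hne
  exact hγ₀' (gamma1_le_of_gamma_le_of_T_mem hGammaN hT hγ₀)

end Summit.BirchSwinnertonDyer.BirchSwinnertonDyer.Theorems.DepletionAtTwo.CongruenceCore

end
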